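import Mathlib
import Summits.Ventures.HodgeRepro.LitRankDodson1

/-!
# LitRankDodson2 — the cyclic case `q²`, group-ring identities for `⟨g, h⟩`, linear-algebra helpers, case (i)

Blind cell `pub-hodge-repro`, seat lit-2. Part 2 of 3 of the former single file `LitRankDodson.lean` (split at the ≤ 400-line rule, gen 4; text of every declaration unchanged). Imports `LitRankDodson1` (and through it the rest of the chain).
-/

open Finset Polynomial
open scoped Pointwise

namespace HodgeRepro.Lit2

/-! ## §2  The cyclic case; §4  group-ring identities for `⟨g, h⟩` -/

namespace CMTriple

/-! ### The cyclic case: an element of order `q²` (Dodson p.54–55, "First, we dispose of the case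
where there is an element x of order q²") -/

section Cyclic

variable {G : Type*} [Group G] [Fintype G] [DecidableEq G] (T : CMTriple G)

omit [Fintype G] [DecidableEq G] in
/-- `Φ_{q²}(rt x) = N_{x^q}` (`Φ_{q²} = Σ_{i<q} X^{qi}`). -/
theorem aeval_rt_cyclotomic_sq (x : G) (q : ℕ) (hq : q.Prime) :
    aeval (rt x) (cyclotomic (q ^ 2) ℚ) = normOp (x ^ q) q := by
  have h := cyclotomic_prime_pow_eq_geom_sum (R := ℚ) (n := 1) hq
  rw [show q ^ (1 + 1) = q ^ 2 from rfl, pow_one] at h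
  rw [h, map_sum]
  unfold normOp
  refine Finset.sum_congr rfl fun i _ => ?_
  rw [map_pow, aeval_X_pow, rt_pow, rt_pow]

/-- **Dodson's cyclic case**: an element of order `q²` (`q` an odd prime) forces `rank ≥ q(q−1) ≥ 2q`
(the `ℚ(ζ_{q²})`-part has dimension `≥ q(q−1)`). -/
theorem two_mul_le_rank_of_orderOf_sq (hs : T.IsSimple) (hcore : T.H.normalCore = ⊥) (q : ℕ)
    (hq : q.Prime) (hq2 : q ≠ 2) {x : G} (hx : orderOf x = q ^ 2) : 2 * q ≤ T.rank := by
  classical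
  have hq3 : 3 ≤ q := by
    have := hq.two_le
    omega
  -- `x^q ≠ 1` moves some conjugate
  have hxq : x ^ q ≠ 1 := pow_ne_one_of_lt_orderOf hq.ne_zero (by rw [hx]; nlinarith)
  have hxqq : (x ^ q) ^ q = 1 := by rw [← pow_mul, ← sq, ← hx, pow_orderOf_eq_one]
  obtain ⟨z, hz⟩ := T.exists_image_mul_ne_of_core hs hcore hxq
  set v : G → ℚ := indFun (T.S.image (· * z)) with hv
  set w : G → ℚ := v - rt (x ^ q) v with hw
  have hvV : v ∈ T.V := T.indFun_image_mem_V z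
  have hwV : w ∈ T.V := T.V.sub_mem hvV (T.rt_mem_V _ hvV)
  have hw0 : w ≠ 0 := by
    intro h0
    rw [hw, sub_eq_zero, hv, T.rt_indFun_image] at h0
    exact hz (indFun_injective h0.symm)
  have hNw : aeval (rt x) (cyclotomic (q ^ 2) ℚ) w = 0 := by
    rw [aeval_rt_cyclotomic_sq x q hq, hw, map_sub, ← Module.End.mul_apply (normOp (x ^ q) q),
      normOp_mul_rt _ q hxqq, sub_self]
  have hli := linearIndependent_pow_apply_of_cyclotomic' (rt x) (q ^ 2) (by positivity) hw0 hNw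
  set W : Submodule ℚ (G → ℚ) :=
    Submodule.span ℚ (Set.range fun k : Fin (Nat.totient (q ^ 2)) => ((rt x) ^ (k : ℕ)) w) with hWdef
  have hWrank : Module.finrank ℚ W = q * (q - 1) := by
    rw [hWdef, finrank_span_eq_card hli, Fintype.card_fin, Nat.totient_prime_pow hq (by norm_num),
      show 2 - 1 = 1 from rfl, pow_one]
  have hWV : W ≤ T.V := by
    rw [hWdef, Submodule.span_le]
    rintro _ ⟨k, rfl⟩
    show (rt x ^ (k : ℕ)) w ∈ T.V
    rw [rt_pow]
    exact T.rt_mem_V _ hwV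
  have h1 := Submodule.finrank_mono hWV
  rw [hWrank] at h1
  rw [T.rank_eq_finrank_V]
  have h2 : q * 2 ≤ q * (q - 1) := Nat.mul_le_mul_left q (by omega)
  omega

end Cyclic

/-! ### The elementary abelian case: group-ring identities for `⟨g, h⟩ ≅ (ℤ/q)²` -/

section ElemAb

variable {G : Type*} [Group G] {g h : G} {q : ℕ}

/-- `y_j = g^j h` has order `q`. -/
theorem orderOf_pow_mul (hq : q.Prime) (hg : orderOf g = q) (hh : orderOf h = q)
    (hgh : g * h = h * g) (hhg : h ∉ Subgroup.zpowers g) (j : ℕ) : orderOf (g ^ j * h) = q := by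
  haveI := Fact.mk hq
  apply orderOf_eq_prime
  · have hg1 : g ^ q = 1 := by rw [← hg, pow_orderOf_eq_one]
    have hh1 : h ^ q = 1 := by rw [← hh, pow_orderOf_eq_one]
    rw [(Commute.pow_left hgh j).mul_pow, ← pow_mul, mul_comm j q, pow_mul, hg1, one_pow, one_mul,
      hh1]
  · intro h1
    apply hhg
    have : h = (g ^ j)⁻¹ := eq_inv_of_mul_eq_one_right h1
    rw [this]
    exact Subgroup.inv_mem _ (Subgroup.npow_mem_zpowers g j)

/-- `N_g` and `N_{y}` commute when `g` and `y` commute. -/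
theorem normOp_comm_normOp {a y : G} (hay : a * y = y * a) (p r : ℕ) :
    normOp a p * normOp y r = normOp y r * normOp a p := by
  conv_lhs => rw [show normOp a p = ∑ k ∈ range p, rt (a ^ k) from rfl]
  conv_rhs => rw [show normOp a p = ∑ k ∈ range p, rt (a ^ k) from rfl]
  rw [Finset.sum_mul, Finset.mul_sum]
  refine Finset.sum_congr rfl fun k _ => ?_
  exact rt_comm_normOp (Commute.pow_left hay k) r

/-- `Σ_{j<q} N_{g^j h} = q • 1 + (N_h − 1) N_g` (each `k ≠ 0` contributes `rt (h^k) N_g`, `k = 0`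
contributes `q • 1`). -/
theorem sum_normOp_pow_mul (hq : q.Prime) (hg : orderOf g = q) (hgh : g * h = h * g) :
    ∑ j : Fin q, normOp (g ^ (j : ℕ) * h) q =
      (q : ℚ) • (1 : Module.End ℚ (G → ℚ)) + (normOp h q - 1) * normOp g q := by
  obtain ⟨q', rfl⟩ : ∃ q', q = q' + 1 := ⟨q - 1, by have := hq.pos; omega⟩
  have hg1 : g ^ (q' + 1) = 1 := by rw [← hg, pow_orderOf_eq_one]
  -- expand every `N_{g^j h}` as a double sum
  have hexp : ∀ j : Fin (q' + 1), normOp (g ^ (j : ℕ) * h) (q' + 1) =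
      ∑ k : Fin (q' + 1), rt (h ^ (k : ℕ)) * rt (g ^ ((k : ℕ) * (j : ℕ))) := by
    intro j
    rw [normOp_eq_sum_fin]
    refine Finset.sum_congr rfl fun k _ => ?_
    rw [Module.End.mul_eq_comp, rt_comp, (Commute.pow_left hgh (j : ℕ)).mul_pow, ← pow_mul,
      mul_comm (j : ℕ) (k : ℕ)]
  simp only [hexp]
  rw [Finset.sum_comm]
  simp only [← Finset.mul_sum]
  rw [Fin.sum_univ_succ]
  -- the `k = 0` term
  have h0 : ∑ j : Fin (q' + 1), rt (g ^ (((0 : Fin (q' + 1)) : ℕ) * (j : ℕ))) =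
      ((q' + 1 : ℕ) : ℚ) • (1 : Module.End ℚ (G → ℚ)) := by
    simp only [Fin.val_zero, zero_mul, pow_zero, rt_one', Finset.sum_const, Finset.card_univ,
      Fintype.card_fin]
    exact (Nat.cast_smul_eq_nsmul ℚ _ _).symm
  -- the `k ≠ 0` terms
  have hk : ∀ k : Fin q', ∑ j : Fin (q' + 1), rt (g ^ (((k.succ : Fin (q' + 1)) : ℕ) * (j : ℕ))) =
      normOp g (q' + 1) := by
    intro k
    apply sum_rt_pow_mul_eq_normOp hq hg
    rw [Fin.val_succ]
    intro hdvd
    have := Nat.le_of_dvd (by omega) hdvd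
    have := k.isLt
    omega
  -- `Σ_{k ≠ 0} rt (h^k) = N_h − 1`
  have hNh : ∑ k : Fin q', rt (h ^ ((k.succ : Fin (q' + 1)) : ℕ)) = normOp h (q' + 1) - 1 := by
    rw [normOp_eq_sum_fin, Fin.sum_univ_succ, Fin.val_zero, pow_zero, rt_one']
    abel
  rw [h0]
  simp only [hk]
  rw [← Finset.sum_mul, hNh, Fin.val_zero, pow_zero, rt_one', one_mul]

/-- `N_{y_j} N_{y_{j'}} = N_g N_{y_{j'}}` for `j ≠ j'` (`y_j = g^{j−j'} y_{j'}` and `⟨g^{j−j'}⟩ = ⟨g⟩`). -/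
theorem normOp_pow_mul_mul (hq : q.Prime) (hg : orderOf g = q) (hh : orderOf h = q)
    (hgh : g * h = h * g) (hhg : h ∉ Subgroup.zpowers g) {j j' : ℕ} (hj : j < q) (hj' : j' < q)
    (hjj : j ≠ j') :
    normOp (g ^ j * h) q * normOp (g ^ j' * h) q = normOp g q * normOp (g ^ j' * h) q := by
  set d := j + (q - j') with hd
  have hg1 : g ^ q = 1 := by rw [← hg, pow_orderOf_eq_one]
  have hy : g ^ j * h = g ^ d * (g ^ j' * h) := by
    rw [← mul_assoc, ← pow_add, hd, add_assoc, Nat.sub_add_cancel hj'.le, pow_add, hg1, mul_one]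
  have hyq : (g ^ j' * h) ^ q = 1 := by
    rw [← orderOf_pow_mul hq hg hh hgh hhg j', pow_orderOf_eq_one]
  have hcomm : g ^ d * (g ^ j' * h) = (g ^ j' * h) * g ^ d := by
    rw [← mul_assoc, ← pow_add, add_comm, pow_add, mul_assoc, (Commute.pow_left hgh d).eq,
      ← mul_assoc]
  have hnd : ¬ q ∣ d := by
    intro hdvd
    obtain ⟨c, hc⟩ := hdvd
    rcases c with _ | _ | c
    · omega
    · omega
    · have : q * 2 ≤ q * (c + 1 + 1) := Nat.mul_le_mul_left q (by omega)
      omega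
  -- term by term
  have hterm : ∀ a : Fin q, rt ((g ^ j * h) ^ (a : ℕ)) * normOp (g ^ j' * h) q =
      rt (g ^ (d * (a : ℕ))) * normOp (g ^ j' * h) q := by
    intro a
    have hc2 : (g ^ j' * h) ^ (a : ℕ) * g ^ (d * (a : ℕ)) =
        g ^ (d * (a : ℕ)) * (g ^ j' * h) ^ (a : ℕ) := by
      rw [pow_mul]
      have hcomm'' : Commute (g ^ j' * h) (g ^ d) := hcomm.symm
      exact (Commute.pow_pow hcomm'' (a : ℕ) (a : ℕ)).eq
    have hcomm' : Commute (g ^ d) (g ^ j' * h) := hcomm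
    rw [hy, hcomm'.mul_pow, ← pow_mul, ← rt_comp, ← Module.End.mul_eq_comp, rt_comm_of_comm hc2,
      mul_assoc, rt_pow_mul_normOp _ q hyq]
  conv_lhs => rw [normOp_eq_sum_fin, Finset.sum_mul]
  simp only [hterm]
  rw [← Finset.sum_mul, sum_rt_pow_mul_eq_normOp hq hg hnd]

end ElemAb

end CMTriple

/-! ## §3  Linear-algebra helpers; case (i) -/

namespace CMTriple

/-! ### Linear-algebra helpers -/

section Helpers

variable {G : Type*} [Group G] [Fintype G] [DecidableEq G]

omit [Group G] [DecidableEq G] in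
/-- Three submodules of `V` with `A ⊓ B = ⊥` and `(A ⊔ B) ⊓ C = ⊥` have `dim A + dim B + dim C ≤ dim V`. -/
theorem finrank_add_three_le {V A B C : Submodule ℚ (G → ℚ)} (hA : A ≤ V) (hB : B ≤ V) (hC : C ≤ V)
    (hAB : A ⊓ B = ⊥) (hABC : (A ⊔ B) ⊓ C = ⊥) :
    Module.finrank ℚ A + Module.finrank ℚ B + Module.finrank ℚ C ≤ Module.finrank ℚ V := by
  have h1 := Submodule.finrank_sup_add_finrank_inf_eq A B
  rw [hAB, finrank_bot, add_zero] at h1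
  have h2 := Submodule.finrank_sup_add_finrank_inf_eq (A ⊔ B) C
  rw [hABC, finrank_bot, add_zero] at h2
  have h3 : Module.finrank ℚ ↥(A ⊔ B ⊔ C) ≤ Module.finrank ℚ V :=
    Submodule.finrank_mono (sup_le (sup_le hA hB) hC)
  omega

omit [Fintype G] [DecidableEq G] in
/-- Vectors fixed by `rt y` and killed by `N_y` vanish (`q ≠ 0`). -/
theorem ker_sub_one_inf_ker_normOp (y : G) (q : ℕ) (hq : q ≠ 0) :
    LinearMap.ker (rt y - 1) ⊓ LinearMap.ker (normOp y q) = ⊥ := by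
  rw [eq_bot_iff]
  intro u hu
  rw [Submodule.mem_inf, LinearMap.mem_ker, LinearMap.mem_ker, LinearMap.sub_apply,
    Module.End.one_apply, sub_eq_zero] at hu
  rw [Submodule.mem_bot]
  have := hu.2
  rw [normOp_apply_of_fixed y q hu.1, smul_eq_zero] at this
  exact this.resolve_left (by exact_mod_cast hq)

omit [Group G] [Fintype G] [DecidableEq G] in
/-- `span {φ^k w}` lies in `ker L` when `L` commutes with `φ` and `L w = 0`. -/
theorem span_pow_le_ker {ι : Type*} (φ L : Module.End ℚ (G → ℚ)) (hc : L * φ = φ * L) {w : G → ℚ}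
    (hw : L w = 0) (e : ι → ℕ) :
    Submodule.span ℚ (Set.range fun k : ι => (φ ^ e k) w) ≤ LinearMap.ker L := by
  rw [Submodule.span_le]
  rintro _ ⟨k, rfl⟩
  show L ((φ ^ e k) w) = 0
  have hck : L * φ ^ e k = φ ^ e k * L := (Commute.pow_right hc (e k))
  rw [← Module.End.mul_apply, hck, Module.End.mul_apply, hw, map_zero]

omit [Fintype G] in
/-- `span {(rt y)^k w}` lies in `V` when `w ∈ V`. -/
theorem span_rt_pow_le_V {ι : Type*} (T : CMTriple G) (y : G) {w : G → ℚ} (hw : w ∈ T.V) (e : ι → ℕ) :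
    Submodule.span ℚ (Set.range fun k : ι => ((rt y) ^ e k) w) ≤ T.V := by
  rw [Submodule.span_le]
  rintro _ ⟨k, rfl⟩
  show ((rt y) ^ e k) w ∈ T.V
  rw [rt_pow]
  exact T.rt_mem_V _ hw

omit [Fintype G] [DecidableEq G] in
/-- Bezout: `Φ_q(rt y) w = N_y w = 0`, `w ≠ 0` gives a `(q−1)`-dimensional span. -/
theorem finrank_span_rt_pow (y : G) (q : ℕ) [Fact q.Prime] {w : G → ℚ} (hw : w ≠ 0)
    (hN : normOp y q w = 0) :
    Module.finrank ℚ (Submodule.span ℚ (Set.range fun k : Fin (q - 1) => ((rt y) ^ (k : ℕ)) w))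
      = q - 1 := by
  have hli := linearIndependent_pow_apply_of_cyclotomic (rt y) q hw
    (by rw [← normOp_eq_aeval_cyclotomic]; exact hN)
  rw [finrank_span_eq_card hli, Fintype.card_fin]

omit [Fintype G] [DecidableEq G] in
/-- `ker (rt y − 1)` is the fixed space. -/
theorem mem_ker_rt_sub_one {y : G} {u : G → ℚ} : u ∈ LinearMap.ker (rt y - 1) ↔ rt y u = u := by
  rw [LinearMap.mem_ker, LinearMap.sub_apply, Module.End.one_apply, sub_eq_zero]

end Helpers

/-! ### The elementary abelian case `⟨g, h⟩ ≅ (ℤ/q)²` (Dodson p.55) -/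

section ElemAbCase

variable {G : Type*} [Group G] [Fintype G] [DecidableEq G] (T : CMTriple G)

/-- A nonzero vector of `V ∩ ker N_g` from faithfulness of `g ≠ 1`. -/
theorem exists_mem_V_ker_normOp_ne_zero (hs : T.IsSimple) (hcore : T.H.normalCore = ⊥) {g : G}
    (hg1 : g ≠ 1) (q : ℕ) (hgq : g ^ q = 1) :
    ∃ w : G → ℚ, w ∈ T.V ∧ normOp g q w = 0 ∧ w ≠ 0 := by
  obtain ⟨x, hx⟩ := T.exists_image_mul_ne_of_core hs hcore hg1
  refine ⟨indFun (T.S.image (· * x)) - rt g (indFun (T.S.image (· * x))),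
    T.V.sub_mem (T.indFun_image_mem_V x) (T.rt_mem_V g (T.indFun_image_mem_V x)), ?_, ?_⟩
  · rw [map_sub, ← Module.End.mul_apply (normOp g q) (rt g), normOp_mul_rt g q hgq, sub_self]
  · intro h0
    rw [sub_eq_zero, T.rt_indFun_image] at h0
    exact hx (indFun_injective h0.symm)

/-- The `g`- and `h`-fixed vector `u₁ = N_h N_g 𝟙_{S̃}` together with `𝟙_G` spans a 2-dimensional
space inside `V`, fixed by `g` and `h`. -/
theorem exists_fixed_two (q : ℕ) (hq : q.Prime) (hq2 : q ≠ 2) {g h : G} (hg : orderOf g = q)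
    (hh : orderOf h = q) (hgh : g * h = h * g) :
    ∃ V₀ : Submodule ℚ (G → ℚ), Module.finrank ℚ V₀ = 2 ∧ V₀ ≤ T.V ∧
      V₀ ≤ LinearMap.ker (rt g - 1) ∧ V₀ ≤ LinearMap.ker (rt h - 1) := by
  classical
  have hg1 : g ^ q = 1 := by rw [← hg, pow_orderOf_eq_one]
  have hh1 : h ^ q = 1 := by rw [← hh, pow_orderOf_eq_one]
  -- `N_h N_g = Σ_{(k,l)} rt (g^l h^k)`
  have hNN : normOp h q * normOp g q =
      ∑ p ∈ (range q) ×ˢ (range q), rt (g ^ p.2 * h ^ p.1) := by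
    rw [show normOp h q = ∑ k ∈ range q, rt (h ^ k) from rfl,
      show normOp g q = ∑ l ∈ range q, rt (g ^ l) from rfl, Finset.sum_mul_sum,
      Finset.sum_product]
    refine Finset.sum_congr rfl fun k _ => Finset.sum_congr rfl fun l _ => ?_
    rw [Module.End.mul_eq_comp, rt_comp]
  set u₁ : G → ℚ := (normOp h q * normOp g q) (indFun T.S) with hu₁
  set u₂ : G → ℚ := fun _ => (1 : ℚ) with hu₂
  have hodd : Odd ((range q ×ˢ range q).card) := by
    rw [Finset.card_product, Finset.card_range]
    exact (hq.eq_two_or_odd'.resolve_left hq2).mul (hq.eq_two_or_odd'.resolve_left hq2)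
  have hli : LinearIndependent ℚ ![u₁, u₂] := by
    rw [hu₁, hNN]
    exact T.linearIndependent_sumRt_one _ _ hodd
  refine ⟨Submodule.span ℚ (Set.range ![u₁, u₂]), ?_, ?_, ?_, ?_⟩
  · rw [finrank_span_eq_card hli, Fintype.card_fin]
  · rw [Submodule.span_le]
    rintro _ ⟨k, rfl⟩
    fin_cases k
    · show u₁ ∈ T.V
      rw [hu₁, Module.End.mul_apply]
      exact T.normOp_mem_V _ _ (T.normOp_mem_V _ _ T.indFun_S_mem_V)
    · exact T.one_mem_V
  · rw [Submodule.span_le]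
    rintro _ ⟨k, rfl⟩
    fin_cases k
    · show u₁ ∈ LinearMap.ker (rt g - 1)
      rw [mem_ker_rt_sub_one, hu₁, ← Module.End.mul_apply, ← mul_assoc,
        rt_comm_normOp hgh q, mul_assoc, rt_mul_normOp g q hg1]
    · show u₂ ∈ LinearMap.ker (rt g - 1)
      rw [mem_ker_rt_sub_one, hu₂, rt_const]
  · rw [Submodule.span_le]
    rintro _ ⟨k, rfl⟩
    fin_cases k
    · show u₁ ∈ LinearMap.ker (rt h - 1)
      rw [mem_ker_rt_sub_one, hu₁, ← Module.End.mul_apply, ← mul_assoc, rt_mul_normOp h q hh1]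
    · show u₂ ∈ LinearMap.ker (rt h - 1)
      rw [mem_ker_rt_sub_one, hu₂, rt_const]

/-- **Case (i)**: some `g`-fixed vector of `V` is moved by `h`. -/
theorem two_mul_le_rank_of_moved (hs : T.IsSimple) (hcore : T.H.normalCore = ⊥) (q : ℕ)
    (hq : q.Prime) (hq2 : q ≠ 2) {g h : G} (hg : orderOf g = q) (hh : orderOf h = q)
    (hgh : g * h = h * g) (hmoved : ∃ u ∈ T.V, rt g u = u ∧ rt h u ≠ u) : 2 * q ≤ T.rank := by
  classical
  haveI := Fact.mk hq
  have hg1 : g ^ q = 1 := by rw [← hg, pow_orderOf_eq_one]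
  have hh1 : h ^ q = 1 := by rw [← hh, pow_orderOf_eq_one]
  have hgne : g ≠ 1 := by
    intro h1; rw [h1, orderOf_one] at hg; exact hq.one_lt.ne hg
  obtain ⟨V₀, hV₀rank, hV₀V, hV₀g, hV₀h⟩ := T.exists_fixed_two q hq hq2 hg hh hgh
  -- `W₂ ⊆ V ∩ Fix(g) ∩ ker N_h`
  obtain ⟨u, huV, hug, huh⟩ := hmoved
  set w₂ : G → ℚ := u - rt h u with hw₂
  have hw₂V : w₂ ∈ T.V := T.V.sub_mem huV (T.rt_mem_V h huV)
  have hw₂0 : w₂ ≠ 0 := by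
    intro h0; rw [hw₂, sub_eq_zero] at h0; exact huh h0.symm
  have hw₂N : normOp h q w₂ = 0 := by
    rw [hw₂, map_sub, ← Module.End.mul_apply (normOp h q) (rt h), normOp_mul_rt h q hh1, sub_self]
  have hw₂g : (rt g - 1) w₂ = 0 := by
    rw [LinearMap.sub_apply, Module.End.one_apply, sub_eq_zero, hw₂, map_sub, hug,
      ← Module.End.mul_apply (rt g) (rt h), rt_comm_of_comm hgh, Module.End.mul_apply, hug]
  set W₂ := Submodule.span ℚ (Set.range fun k : Fin (q - 1) => ((rt h) ^ (k : ℕ)) w₂) with hW₂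
  have hW₂rank : Module.finrank ℚ W₂ = q - 1 := finrank_span_rt_pow h q hw₂0 hw₂N
  have hW₂V : W₂ ≤ T.V := T.span_rt_pow_le_V h hw₂V _
  have hW₂N : W₂ ≤ LinearMap.ker (normOp h q) :=
    span_pow_le_ker (rt h) (normOp h q) ((normOp_mul_rt h q hh1).trans (rt_mul_normOp h q hh1).symm)
      hw₂N _
  have hW₂g : W₂ ≤ LinearMap.ker (rt g - 1) :=
    span_pow_le_ker (rt h) (rt g - 1) (by rw [sub_mul, mul_sub, one_mul, mul_one, rt_comm_of_comm hgh])
      hw₂g _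
  -- `W₁ ⊆ V ∩ ker N_g`
  obtain ⟨w₁, hw₁V, hw₁N, hw₁0⟩ := T.exists_mem_V_ker_normOp_ne_zero hs hcore hgne q hg1
  set W₁ := Submodule.span ℚ (Set.range fun k : Fin (q - 1) => ((rt g) ^ (k : ℕ)) w₁) with hW₁
  have hW₁rank : Module.finrank ℚ W₁ = q - 1 := finrank_span_rt_pow g q hw₁0 hw₁N
  have hW₁V : W₁ ≤ T.V := T.span_rt_pow_le_V g hw₁V _
  have hW₁N : W₁ ≤ LinearMap.ker (normOp g q) :=
    span_pow_le_ker (rt g) (normOp g q) ((normOp_mul_rt g q hg1).trans (rt_mul_normOp g q hg1).symm)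
      hw₁N _
  -- the three pieces are independent
  have hAB : V₀ ⊓ W₂ = ⊥ := by
    rw [eq_bot_iff]
    refine le_trans (inf_le_inf hV₀h hW₂N) ?_
    rw [ker_sub_one_inf_ker_normOp h q hq.ne_zero]
  have hABC : (V₀ ⊔ W₂) ⊓ W₁ = ⊥ := by
    rw [eq_bot_iff]
    refine le_trans (inf_le_inf (sup_le hV₀g hW₂g) hW₁N) ?_
    rw [ker_sub_one_inf_ker_normOp g q hq.ne_zero]
  have := finrank_add_three_le hV₀V hW₂V hW₁V hAB hABC
  rw [hV₀rank, hW₂rank, hW₁rank, ← T.rank_eq_finrank_V] at this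
  have := hq.two_le
  omega

end ElemAbCase

end CMTriple

end HodgeRepro.Lit2
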